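import Mathlib.LinearAlgebra.Matrix.GeneralLinearGroup.Defs
import Mathlib.LinearAlgebra.BilinearMap
import Mathlib.Data.Matrix.Mul
import HarnessLib

/-!
# Eigenlines of a regular diagonal (or diagonalisable) matrix are the frame lines; anisotropic frames carry no isotropic eigenline

Topic `LinearAlgebra`; namespace `Literature.LinearAlgebra`.  THEOREMS ONLY (no definition, no instance, no notation, no named fact, no `sorry`); Mathlib only.
Cell `pub/hodgecm-mathlib`, F0∕P3a, crux H413 = `stmt-HodgeConjecture-24833`, road «S3-tree» (deal sheet CENSUS «S3» v3; «tree organs» hand F0P3a-p08 (g17)).  MOTIVATION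
(CENSUS-T2 75083796 (E2) «DEPTH-0 RIGIDITY», F0P2-p02 (g10)): «a REGULAR residual element (`s_i ≢ s_j mod 𝔭_E`) fixes NO neighbour of `x_T` — isotropic lines of the residual
hermitian∕quadratic space fixed by a regular diagonal element are coordinate lines, which are anisotropic ⇒ `Fix = {x_T}`».  The linear algebra behind it, over ANY commutative
ring without zero divisors ∕ any field, in `mulVec` currency (the currency of ★ `UnitaryAntidiagFrames` ∕ `UnitaryThreeUnipotentConjugacy`):
* §1 `diagonal_mulVec_eq_smul_iff` — `diag(d)·v = μ v ↔ ∀ i, (d i − μ)·v i = 0`; **`exists_eq_single_of_diagonal_mulVec_eq_smul`** — if the `d i` are pairwise distinct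
  (`d` injective) then every eigenvector is a COORDINATE vector: `v ≠ 0`, `diag(d)·v = μ v ⇒ ∃ i, μ = d i ∧ v = Pi.single i (v i)`.
* §2 (frames) **`exists_eq_smul_mulVec_single_of_conj_diagonal`** — for `g = P·diag(d)·P⁻¹` (`P ∈ GL_n`) with `d` injective, every eigenvector of `g` lies on a FRAME LINE:
  `g·v = μ v`, `v ≠ 0 ⇒ ∃ i c, c ≠ 0 ∧ μ = d i ∧ v = c • (P·e_i)`.
* §3 (forms) `sesq_smul_smul` — for a `σ`-sesquilinear `B`, `B (c•x) (c•x) = σ c · c · B x x`; **`sesq_self_ne_zero_of_eigenvector_of_anisotropic_frame`** — if the frame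
  vectors `P·e_i` are ANISOTROPIC (`B (P e_i) (P e_i) ≠ 0`) then no non-zero eigenvector of `g = P·diag(d)·P⁻¹` (`d` injective) is isotropic; equivalently
  **`not_exists_isotropic_eigenvector`**: a regular element of a torus with an anisotropic orthogonal eigenframe FIXES NO ISOTROPIC LINE.
HONEST LABEL: HC_CM is proved only modulo the printed citations (the 2 remaining named inputs hLiu418, h413) until rung 0 closes; elementary linear algebra only.

## References
* [Serre1980Trees] J.-P. Serre, *Trees*, Springer (1980), II.1.3 (the action of a split torus on the tree: fixed points of regular elements).
* S. Axler, *Linear Algebra Done Right*, 3rd ed., 5.C (eigenvectors of diagonal operators) — folklore.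
-/

set_option autoImplicit false

open Matrix

namespace Literature.LinearAlgebra

variable {R : Type*} [CommRing R] {n : Type*} [Fintype n] [DecidableEq n]

/-! ## §1 Eigenvectors of a regular diagonal matrix are coordinate vectors -/

/-- `diag(d)·v = μ•v` iff `(d i − μ)·v i = 0` for every `i`. [folklore] [cite: Serre1980Trees, II.1.3] -/
theorem diagonal_mulVec_eq_smul_iff (d : n → R) (v : n → R) (μ : R) :
    Matrix.diagonal d *ᵥ v = μ • v ↔ ∀ i, (d i - μ) * v i = 0 := by
  rw [funext_iff]
  refine forall_congr' fun i => ?_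
  rw [Matrix.mulVec_diagonal, Pi.smul_apply, smul_eq_mul, sub_mul, sub_eq_zero]

/-- **An eigenvector of a diagonal matrix with pairwise distinct entries is a coordinate vector**: if `d` is injective, `v ≠ 0` and `diag(d)·v = μ•v` then `μ = d i` and
`v = Pi.single i (v i)` for the (unique) index `i` with `v i ≠ 0` (no zero divisors). [folklore] [cite: Serre1980Trees, II.1.3] -/
theorem exists_eq_single_of_diagonal_mulVec_eq_smul [NoZeroDivisors R] {d : n → R} (hd : Function.Injective d) {v : n → R} (hv : v ≠ 0) {μ : R}
    (h : Matrix.diagonal d *ᵥ v = μ • v) : ∃ i, μ = d i ∧ v i ≠ 0 ∧ v = Pi.single i (v i) := by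
  rw [diagonal_mulVec_eq_smul_iff] at h
  obtain ⟨i, hi⟩ : ∃ i, v i ≠ 0 := by
    by_contra hall
    exact hv (funext fun i => not_not.1 (not_exists.1 hall i))
  have hμ : μ = d i := by
    have := h i
    rcases mul_eq_zero.1 this with h1 | h1
    · exact (sub_eq_zero.1 h1).symm
    · exact absurd h1 hi
  refine ⟨i, hμ, hi, funext fun j => ?_⟩
  by_cases hj : j = i
  · rw [hj, Pi.single_eq_same]
  · rw [Pi.single_eq_of_ne hj]
    have := h j
    rcases mul_eq_zero.1 this with h1 | h1
    · exact absurd (hd ((sub_eq_zero.1 h1).trans hμ)) hj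
    · exact h1

/-! ## §2 Eigenvectors of `P·diag(d)·P⁻¹` lie on the frame lines `P·e_i` -/

/-- Transport of the eigen-equation through a frame: for `g = P·diag(d)·P⁻¹`, `g·v = μ•v ↔ diag(d)·(P⁻¹ v) = μ•(P⁻¹ v)`. [folklore] [cite: Serre1980Trees, II.1.3] -/
theorem conj_diagonal_mulVec_eq_smul_iff (P : GL n R) (d : n → R) (v : n → R) (μ : R) :
    ((P : Matrix n n R) * Matrix.diagonal d * ((P⁻¹ : GL n R) : Matrix n n R)) *ᵥ v = μ • v ↔
      Matrix.diagonal d *ᵥ (((P⁻¹ : GL n R) : Matrix n n R) *ᵥ v) = μ • (((P⁻¹ : GL n R) : Matrix n n R) *ᵥ v) := by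
  have hPP : ((P⁻¹ : GL n R) : Matrix n n R) * (P : Matrix n n R) = 1 := Units.inv_mul P
  have hPP' : (P : Matrix n n R) * ((P⁻¹ : GL n R) : Matrix n n R) = 1 := Units.mul_inv P
  constructor
  · intro h
    have h' : ((P⁻¹ : GL n R) : Matrix n n R) *ᵥ (((P : Matrix n n R) * Matrix.diagonal d * ((P⁻¹ : GL n R) : Matrix n n R)) *ᵥ v) =
        ((P⁻¹ : GL n R) : Matrix n n R) *ᵥ (μ • v) := by rw [h]
    rwa [Matrix.mulVec_mulVec, Matrix.mulVec_smul, ← mul_assoc, ← mul_assoc, hPP, one_mul, ← Matrix.mulVec_mulVec] at h'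
  · intro h
    have h' : (P : Matrix n n R) *ᵥ (Matrix.diagonal d *ᵥ (((P⁻¹ : GL n R) : Matrix n n R) *ᵥ v)) =
        (P : Matrix n n R) *ᵥ (μ • (((P⁻¹ : GL n R) : Matrix n n R) *ᵥ v)) := by rw [h]
    rw [Matrix.mulVec_mulVec, Matrix.mulVec_smul, Matrix.mulVec_mulVec, Matrix.mulVec_mulVec, hPP', Matrix.one_mulVec] at h'
    exact h'

/-- **Every eigenvector of `g = P·diag(d)·P⁻¹` (`d` injective) lies on a frame line**: `g·v = μ•v`, `v ≠ 0 ⇒ ∃ i c, c ≠ 0 ∧ μ = d i ∧ v = c • (P·e_i)`, namely `c = (P⁻¹ v) i`.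
[folklore] [cite: Serre1980Trees, II.1.3] -/
theorem exists_eq_smul_mulVec_single_of_conj_diagonal [NoZeroDivisors R] (P : GL n R) {d : n → R} (hd : Function.Injective d) {v : n → R} (hv : v ≠ 0) {μ : R}
    (h : ((P : Matrix n n R) * Matrix.diagonal d * ((P⁻¹ : GL n R) : Matrix n n R)) *ᵥ v = μ • v) :
    ∃ (i : n) (c : R), c ≠ 0 ∧ μ = d i ∧ v = c • ((P : Matrix n n R) *ᵥ Pi.single i 1) := by
  have hPP' : (P : Matrix n n R) * ((P⁻¹ : GL n R) : Matrix n n R) = 1 := Units.mul_inv P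
  rw [conj_diagonal_mulVec_eq_smul_iff] at h
  have hw : ((P⁻¹ : GL n R) : Matrix n n R) *ᵥ v ≠ 0 := by
    intro h0
    apply hv
    have h1 : (P : Matrix n n R) *ᵥ (((P⁻¹ : GL n R) : Matrix n n R) *ᵥ v) = (P : Matrix n n R) *ᵥ 0 := by rw [h0]
    rwa [Matrix.mulVec_mulVec, hPP', Matrix.one_mulVec, Matrix.mulVec_zero] at h1
  obtain ⟨i, hμ, hci, hsingle⟩ := exists_eq_single_of_diagonal_mulVec_eq_smul hd hw h
  refine ⟨i, (((P⁻¹ : GL n R) : Matrix n n R) *ᵥ v) i, hci, hμ, ?_⟩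
  have hv' : v = (P : Matrix n n R) *ᵥ (((P⁻¹ : GL n R) : Matrix n n R) *ᵥ v) := by
    rw [Matrix.mulVec_mulVec, hPP', Matrix.one_mulVec]
  conv_lhs => rw [hv', hsingle]
  rw [← Matrix.mulVec_smul]
  congr 1
  ext j
  rw [Pi.smul_apply, smul_eq_mul, Pi.single_apply, Pi.single_apply, mul_ite, mul_one, mul_zero]

/-! ## §3 Anisotropic frames carry no isotropic eigenline -/

section Forms

variable {K : Type*} [Field K] {σ : K →+* K} {m : Type*}

/-- For a `σ`-sesquilinear form, `B (c•x) (c•x) = σ c · c · B x x`. [folklore] [cite: Serre1980Trees, II.1.3] -/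
theorem sesq_smul_smul (B : (m → K) →ₛₗ[σ] (m → K) →ₗ[K] K) (c : K) (x : m → K) : B (c • x) (c • x) = σ c * c * B x x := by
  rw [LinearMap.map_smulₛₗ, LinearMap.map_smulₛₗ, LinearMap.smul_apply, RingHom.id_apply, smul_eq_mul, smul_eq_mul]
  ring

/-- **No non-zero eigenvector of `P·diag(d)·P⁻¹` (`d` injective) is isotropic when the frame vectors `P·e_i` are anisotropic** (`B (P e_i) (P e_i) ≠ 0`): the eigenvector is
`c • P e_i` with `c ≠ 0`, and `B(c P e_i, c P e_i) = σc·c·B(P e_i, P e_i) ≠ 0`. [folklore] [cite: Serre1980Trees, II.1.3] -/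
theorem sesq_self_ne_zero_of_eigenvector_of_anisotropic_frame [Fintype m] [DecidableEq m] (B : (m → K) →ₛₗ[σ] (m → K) →ₗ[K] K) (P : GL m K) {d : m → K} (hd : Function.Injective d)
    (haniso : ∀ i, B ((P : Matrix m m K) *ᵥ Pi.single i 1) ((P : Matrix m m K) *ᵥ Pi.single i 1) ≠ 0) {v : m → K} (hv : v ≠ 0) {μ : K}
    (h : ((P : Matrix m m K) * Matrix.diagonal d * ((P⁻¹ : GL m K) : Matrix m m K)) *ᵥ v = μ • v) : B v v ≠ 0 := by
  obtain ⟨i, c, hc, -, rfl⟩ := exists_eq_smul_mulVec_single_of_conj_diagonal P hd hv h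
  rw [sesq_smul_smul]
  exact mul_ne_zero (mul_ne_zero ((map_ne_zero σ).2 hc) hc) (haniso i)

/-- **DEPTH-ZERO RIGIDITY (linear-algebra form): a regular element of a torus with an anisotropic orthogonal eigenframe fixes no isotropic line** — there is no `v ≠ 0` with
`B v v = 0` and `g·v = μ•v`, `g = P·diag(d)·P⁻¹`, `d` injective, `B (P e_i) (P e_i) ≠ 0`. [folklore] [cite: Serre1980Trees, II.1.3] -/
theorem not_exists_isotropic_eigenvector [Fintype m] [DecidableEq m] (B : (m → K) →ₛₗ[σ] (m → K) →ₗ[K] K) (P : GL m K) {d : m → K} (hd : Function.Injective d)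
    (haniso : ∀ i, B ((P : Matrix m m K) *ᵥ Pi.single i 1) ((P : Matrix m m K) *ᵥ Pi.single i 1) ≠ 0) :
    ¬ ∃ (v : m → K) (μ : K), v ≠ 0 ∧ B v v = 0 ∧ ((P : Matrix m m K) * Matrix.diagonal d * ((P⁻¹ : GL m K) : Matrix m m K)) *ᵥ v = μ • v := by
  rintro ⟨v, μ, hv, hiso, h⟩
  exact sesq_self_ne_zero_of_eigenvector_of_anisotropic_frame B P hd haniso hv h hiso

end Forms


/-! ## §4 (ED. 2) Non-regular diagonal elements: eigenvectors are supported on the eigen-coordinates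

ED. 2 (F0P3a-p08 (g17), same day; previous declarations byte-identical).  For T2-E′ «THE LOCAL FIXED-SPHERE DICTIONARY» (architect A-p16 (g29) A-63: the residual element may have a
REPEATED eigenvalue — «one repeated eigenvalue on a non-degenerate eigenplane ⇒ `q+1`; scalar ⇒ `q³+1`»): without injectivity of `d`, an eigenvector for `μ` has non-zero coordinates only where
`d i = μ`, so in frame currency it lies in the span of the frame vectors `P·e_i` with `d i = μ` (the eigenplane ∕ the whole space). -/

/-- An eigenvector of `diag(d)` for `μ` vanishes at every coordinate `i` with `d i ≠ μ` (no zero divisors). [folklore] [cite: Serre1980Trees, II.1.3] -/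
theorem apply_eq_zero_of_diagonal_mulVec_eq_smul [NoZeroDivisors R] {d : n → R} {v : n → R} {μ : R} (h : Matrix.diagonal d *ᵥ v = μ • v) {i : n}
    (hi : d i ≠ μ) : v i = 0 := by
  rw [diagonal_mulVec_eq_smul_iff] at h
  rcases mul_eq_zero.1 (h i) with h1 | h1
  · exact absurd (sub_eq_zero.1 h1) hi
  · exact h1

/-- A non-zero eigenvector of `diag(d)` for `μ` has a non-zero coordinate `i` with `d i = μ` (so `μ` is one of the entries). [folklore] [cite: Serre1980Trees, II.1.3] -/
theorem exists_apply_ne_zero_of_diagonal_mulVec_eq_smul [NoZeroDivisors R] {d : n → R} {v : n → R} (hv : v ≠ 0) {μ : R} (h : Matrix.diagonal d *ᵥ v = μ • v) :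
    ∃ i, v i ≠ 0 ∧ d i = μ := by
  obtain ⟨i, hi⟩ : ∃ i, v i ≠ 0 := by
    by_contra hall
    exact hv (funext fun i => not_not.1 (not_exists.1 hall i))
  exact ⟨i, hi, by_contra fun hne => hi (apply_eq_zero_of_diagonal_mulVec_eq_smul h hne)⟩

/-- **Frame form**: an eigenvector of `g = P·diag(d)·P⁻¹` for `μ` has frame coordinates `(P⁻¹ v) i = 0` wherever `d i ≠ μ`, and `v = Σ_i (P⁻¹ v)_i • P e_i`; hence
`v ∈ span {P e_i : d i = μ}` (the `μ`-eigenspace is spanned by the frame vectors of eigenvalue `μ`). [folklore] [cite: Serre1980Trees, II.1.3] -/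
theorem mem_span_frame_of_conj_diagonal_mulVec_eq_smul [NoZeroDivisors R] (P : GL n R) {d : n → R} {v : n → R} {μ : R}
    (h : ((P : Matrix n n R) * Matrix.diagonal d * ((P⁻¹ : GL n R) : Matrix n n R)) *ᵥ v = μ • v) :
    (∀ i, d i ≠ μ → (((P⁻¹ : GL n R) : Matrix n n R) *ᵥ v) i = 0) ∧
      v ∈ Submodule.span R (Set.range fun i : {i : n // d i = μ} => (P : Matrix n n R) *ᵥ Pi.single i.1 1) := by
  have hPP' : (P : Matrix n n R) * ((P⁻¹ : GL n R) : Matrix n n R) = 1 := Units.mul_inv P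
  rw [conj_diagonal_mulVec_eq_smul_iff] at h
  have hzero : ∀ i, d i ≠ μ → (((P⁻¹ : GL n R) : Matrix n n R) *ᵥ v) i = 0 := fun i hi => apply_eq_zero_of_diagonal_mulVec_eq_smul h hi
  refine ⟨hzero, ?_⟩
  -- `v = P (P⁻¹ v) = Σ_i (P⁻¹ v)_i • P e_i`, and the terms with `d i ≠ μ` vanish
  set w : n → R := ((P⁻¹ : GL n R) : Matrix n n R) *ᵥ v with hw
  have hv : v = ∑ i, w i • ((P : Matrix n n R) *ᵥ Pi.single i 1) := by
    calc v = (P : Matrix n n R) *ᵥ w := by rw [hw, Matrix.mulVec_mulVec, hPP', Matrix.one_mulVec]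
      _ = (P : Matrix n n R) *ᵥ ∑ i, Pi.single i (w i) := by rw [Finset.univ_sum_single]
      _ = ∑ i, (P : Matrix n n R) *ᵥ Pi.single i (w i) := Matrix.mulVec_sum _ _ _
      _ = ∑ i, w i • ((P : Matrix n n R) *ᵥ Pi.single i 1) := Finset.sum_congr rfl fun i _ => by
            rw [← Matrix.mulVec_smul]
            congr 1
            ext j
            rw [Pi.smul_apply, smul_eq_mul, Pi.single_apply, Pi.single_apply, mul_ite, mul_one, mul_zero]
  rw [hv]
  refine Submodule.sum_mem _ fun i _ => ?_
  by_cases hi : d i = μ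
  · exact Submodule.smul_mem _ _ (Submodule.subset_span ⟨⟨i, hi⟩, rfl⟩)
  · rw [hzero i hi, zero_smul]
    exact Submodule.zero_mem _

end Literature.LinearAlgebra
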